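import Summits.QuantumFields.YangMills.Theorems.F4SubCurvatureDoorCauchyKernel
import Mathlib
import HarnessLib

/-!
# Two non-perpendicular RP mirrors: fibre inequalities and containments

Helper (definition-free) for the by-name rung `TwoMirrorLFConstancy` / `HexagonalLFConstancy` of LINE g19-A «transverse
slice» on crux ⟨stmt-QuantumFields-23035⟩ (rung file `Cruxes/ShortRootRigidity/Lines/transverse_slice_rung_bounded.lean`);
companion of `…F4SubCurvatureDoorTwoMirrorCore` (the contradiction), which see for the argument.  Here: the ONE-FIBRE forms of
step (B) (along the ROTATED fibres the window `[cρ - N, cρ + N + 1]` is moved inward to `[cρ/4, cρ/2]`, gain `(cρ/4)/(2N+1)`) and of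
step (C) (along the HORIZONTAL fibres the section of the parallelogram `P = rot⁻¹([cρ/4, cρ/2] × [-sρ-N-1, -sρ+N])` is moved inward
to the section of `V = [-s²ρ/2, s²ρ/2] × T`, gain `s³ρ/(2N+1)`), both instances of the scale-free Cauchy monotonicity
`…CauchyKernel.cauchy_preimage_mul_Icc_ratio`; the geometry of `P` (`parallelogram_geometry`: `q₀ ≥ s²ρ/2`, a horizontal window of
length `(2N+1)/s`, `q₁ ∈ T`); and the two containments (far frame box `⊆` rotated box; `V ⊆ {|q₁| ≥ n₀}`).

HONEST LABEL: elementary real-variable bookkeeping; nothing about ⟨23035⟩, R2d or any summit is proved by this file.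
-/

noncomputable section

open MeasureTheory Set Filter Topology
open scoped ENNReal NNReal

namespace Summit.QuantumFields.YangMills.Theorems.F4SubCurvatureDoorTwoMirrorFibres

open Summit.QuantumFields.YangMills.Theorems.F4SubCurvatureDoorCauchyKernel

/-! ## Elementary facts about `c, s > 0`, `c² + s² = 1` -/

/-- `c ≤ 1`. -/
theorem c_le_one {c s : ℝ} (hcs : c ^ 2 + s ^ 2 = 1) : c ≤ 1 := by
  nlinarith [sq_nonneg s, sq_nonneg (c - 1)]

/-- `s ≤ 1`. -/
theorem s_le_one {c s : ℝ} (hcs : c ^ 2 + s ^ 2 = 1) : s ≤ 1 := by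
  nlinarith [sq_nonneg c, sq_nonneg (s - 1)]

/-! ## Step (B): along the rotated fibres -/

/-- Step (B), one fibre: for `E ≥ 0` and any cross-section condition on the second coordinate, moving the rotated-fibre window
`[cρ - N, cρ + N + 1]` inward to `[cρ/4, cρ/2]` gains the factor `(cρ/4)/(2N+1)`. -/
theorem fibre_stepB {c ρ N E q : ℝ} (S : Set ℝ) (hE : 0 ≤ E) (hN : 1 ≤ N) (hρ1 : N ≤ c * ρ / 2) :
    ENNReal.ofReal ((c * ρ / 2 - c * ρ / 4) / (2 * N + 1)) *
        (volume.withDensity fun x : ℝ => ENNReal.ofReal (Real.pi⁻¹ * (1 + x ^ 2)⁻¹))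
          {x : ℝ | (E * x, q) ∈ Icc (c * ρ - N) (c * ρ + N + 1) ×ˢ S}
      ≤ (volume.withDensity fun x : ℝ => ENNReal.ofReal (Real.pi⁻¹ * (1 + x ^ 2)⁻¹))
          {x : ℝ | (E * x, q) ∈ Icc (c * ρ / 4) (c * ρ / 2) ×ˢ S} := by
  by_cases hq : q ∈ S
  · have e1 : {x : ℝ | (E * x, q) ∈ Icc (c * ρ - N) (c * ρ + N + 1) ×ˢ S}
        = {x : ℝ | E * x ∈ Icc (c * ρ - N) (c * ρ + N + 1)} := by
      ext x; simp [mem_prod, hq]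
    have e2 : {x : ℝ | (E * x, q) ∈ Icc (c * ρ / 4) (c * ρ / 2) ×ˢ S}
        = {x : ℝ | E * x ∈ Icc (c * ρ / 4) (c * ρ / 2)} := by
      ext x; simp [mem_prod, hq]
    rw [e1, e2]
    rcases hE.lt_or_eq with hE' | hE'
    · refine cauchy_preimage_mul_Icc_ratio hE' ?_ ?_ ?_ ?_ ?_
      · have : 0 ≤ c * ρ := by linarith
        linarith
      · have : 0 ≤ c * ρ := by linarith
        linarith
      · linarith
      · linarith
      · linarith
    · -- E = 0: the outer preimage is empty
      have e3 : {x : ℝ | E * x ∈ Icc (c * ρ - N) (c * ρ + N + 1)} = ∅ := by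
        ext x
        simp only [mem_setOf_eq, mem_Icc, mem_empty_iff_false, iff_false, not_and, not_le, ← hE', zero_mul]
        intro h
        linarith
      rw [e3, measure_empty, mul_zero]
      exact bot_le
  · have e1 : {x : ℝ | (E * x, q) ∈ Icc (c * ρ - N) (c * ρ + N + 1) ×ˢ S} = ∅ := by
      ext x; simp [mem_prod, hq]
    rw [e1, measure_empty, mul_zero]
    exact bot_le

/-! ## Step (C): along the horizontal fibres -/

/-- Geometry of the parallelogram `P = rot⁻¹([cρ/4, cρ/2] × [-sρ-N-1, -sρ+N])`: every point has first coordinate `≥ s²ρ/2`,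
lies in an explicit horizontal window of length `(2N+1)/s`, and has second coordinate in
`T = [-(3/4)scρ - N - 1, -scρ/2 + N]`. -/
theorem parallelogram_geometry {c s ρ N a q : ℝ} (hc : 0 < c) (hs : 0 < s) (hcs : c ^ 2 + s ^ 2 = 1) (hN : 1 ≤ N)
    (hρ2 : N ≤ s ^ 2 * ρ / 2)
    (hw : c * a + s * q ∈ Icc (c * ρ / 4) (c * ρ / 2)) (hσ : -s * a + c * q ∈ Icc (-s * ρ - N - 1) (-s * ρ + N)) :
    s ^ 2 * ρ / 2 ≤ a ∧
      a ∈ Icc ((s * ρ - N + c * q) / s) ((s * ρ + N + 1 + c * q) / s) ∧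
      q ∈ Icc (-(3 / 4) * s * c * ρ - N - 1) (-(s * c * ρ) / 2 + N) := by
  have hc1 := c_le_one hcs
  have hs1 := s_le_one hcs
  obtain ⟨hw1, hw2⟩ := hw
  obtain ⟨hσ1, hσ2⟩ := hσ
  have key1 : a = c * (c * a + s * q) - s * (-s * a + c * q) := by linear_combination (-a) * hcs
  have key2 : q = s * (c * a + s * q) + c * (-s * a + c * q) := by linear_combination (-q) * hcs
  have hρ0 : 0 ≤ ρ := by nlinarith
  refine ⟨?_, ⟨?_, ?_⟩, ⟨?_, ?_⟩⟩
  · have h1 : c * (c * ρ / 4) ≤ c * (c * a + s * q) := mul_le_mul_of_nonneg_left hw1 hc.le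
    have h2 : s * (-s * a + c * q) ≤ s * (-s * ρ + N) := mul_le_mul_of_nonneg_left hσ2 hs.le
    have h3 : 0 ≤ c * (c * ρ / 4) := by positivity
    have h4 : s * N ≤ N := by nlinarith
    nlinarith
  · rw [div_le_iff₀ hs]
    linarith
  · rw [le_div_iff₀ hs]
    linarith
  · have h1 : s * (c * ρ / 4) ≤ s * (c * a + s * q) := mul_le_mul_of_nonneg_left hw1 hs.le
    have h2 : c * (-s * ρ - N - 1) ≤ c * (-s * a + c * q) := mul_le_mul_of_nonneg_left hσ1 hc.le
    have h3 : c * (N + 1) ≤ N + 1 := by nlinarith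
    nlinarith
  · have h1 : s * (c * a + s * q) ≤ s * (c * ρ / 2) := mul_le_mul_of_nonneg_left hw2 hs.le
    have h2 : c * (-s * a + c * q) ≤ c * (-s * ρ + N) := mul_le_mul_of_nonneg_left hσ2 hc.le
    have h3 : c * N ≤ N := by nlinarith
    nlinarith

/-- Step (C), one fibre: for `E ≥ 0`, the horizontal section of the parallelogram `P` is moved inward to the section of
`V = [-s²ρ/2, s²ρ/2] × T`, gaining the factor `s²ρ/((2N+1)/s)`. -/
theorem fibre_stepC {c s ρ N E q : ℝ} (hc : 0 < c) (hs : 0 < s) (hcs : c ^ 2 + s ^ 2 = 1) (hE : 0 ≤ E) (hN : 1 ≤ N)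
    (hρ2 : N ≤ s ^ 2 * ρ / 2) :
    ENNReal.ofReal ((s ^ 2 * ρ / 2 - -(s ^ 2 * ρ / 2)) / ((2 * N + 1) / s)) *
        (volume.withDensity fun x : ℝ => ENNReal.ofReal (Real.pi⁻¹ * (1 + x ^ 2)⁻¹))
          {x : ℝ | (E * x, q) ∈ {q' : ℝ × ℝ | (c * q'.1 + s * q'.2, -s * q'.1 + c * q'.2)
              ∈ Icc (c * ρ / 4) (c * ρ / 2) ×ˢ Icc (-s * ρ - N - 1) (-s * ρ + N)}}
      ≤ (volume.withDensity fun x : ℝ => ENNReal.ofReal (Real.pi⁻¹ * (1 + x ^ 2)⁻¹))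
          {x : ℝ | (E * x, q) ∈ Icc (-(s ^ 2 * ρ / 2)) (s ^ 2 * ρ / 2) ×ˢ
              Icc (-(3 / 4) * s * c * ρ - N - 1) (-(s * c * ρ) / 2 + N)} := by
  set C : Measure ℝ := volume.withDensity fun x : ℝ => ENNReal.ofReal (Real.pi⁻¹ * (1 + x ^ 2)⁻¹) with hC
  set Psec := {x : ℝ | (E * x, q) ∈ {q' : ℝ × ℝ | (c * q'.1 + s * q'.2, -s * q'.1 + c * q'.2)
              ∈ Icc (c * ρ / 4) (c * ρ / 2) ×ˢ Icc (-s * ρ - N - 1) (-s * ρ + N)}} with hPsec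
  rcases Psec.eq_empty_or_nonempty with h0 | ⟨x₀, hx₀⟩
  · rw [h0, measure_empty, mul_zero]
    exact bot_le
  -- a witness gives `q ∈ T` and `E > 0`
  have hx₀' := hx₀
  simp only [hPsec, mem_setOf_eq, mem_prod] at hx₀'
  obtain ⟨ha₀, hI₀, hqT⟩ := parallelogram_geometry hc hs hcs hN hρ2 hx₀'.1 hx₀'.2
  have ha1pos : 0 < s ^ 2 * ρ / 2 := by
    have : 0 < s ^ 2 := by positivity
    nlinarith
  have hE' : 0 < E := by
    rcases hE.lt_or_eq with h | h
    · exact h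
    · exfalso
      rw [← h, zero_mul] at ha₀
      linarith
  -- the section lies in an explicit window
  set lo := (s * ρ - N + c * q) / s with hlo
  set hi := (s * ρ + N + 1 + c * q) / s with hhi
  have hsub : Psec ⊆ {x : ℝ | E * x ∈ Icc (max (s ^ 2 * ρ / 2) lo) hi} := by
    intro x hx
    simp only [hPsec, mem_setOf_eq, mem_prod] at hx
    obtain ⟨ha, hI, -⟩ := parallelogram_geometry hc hs hcs hN hρ2 hx.1 hx.2
    simp only [mem_setOf_eq, mem_Icc]
    exact ⟨max_le ha hI.1, hI.2⟩
  have eV : {x : ℝ | (E * x, q) ∈ Icc (-(s ^ 2 * ρ / 2)) (s ^ 2 * ρ / 2) ×ˢ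
        Icc (-(3 / 4) * s * c * ρ - N - 1) (-(s * c * ρ) / 2 + N)}
      = {x : ℝ | E * x ∈ Icc (-(s ^ 2 * ρ / 2)) (s ^ 2 * ρ / 2)} := by
    ext x
    simp only [mem_setOf_eq, mem_prod, hqT, and_true]
  rw [eV]
  calc ENNReal.ofReal ((s ^ 2 * ρ / 2 - -(s ^ 2 * ρ / 2)) / ((2 * N + 1) / s)) * C Psec
      ≤ ENNReal.ofReal ((s ^ 2 * ρ / 2 - -(s ^ 2 * ρ / 2)) / ((2 * N + 1) / s)) *
          C {x : ℝ | E * x ∈ Icc (max (s ^ 2 * ρ / 2) lo) hi} := by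
        gcongr
    _ ≤ C {x : ℝ | E * x ∈ Icc (-(s ^ 2 * ρ / 2)) (s ^ 2 * ρ / 2)} := by
        refine cauchy_preimage_mul_Icc_ratio hE' (by linarith) ?_ (le_max_left _ _) ?_ (by positivity)
        · linarith [le_max_left (s ^ 2 * ρ / 2) lo]
        · have h1 : hi - lo = (2 * N + 1) / s := by
            simp only [hhi, hlo]
            field_simp
            ring
          linarith [le_max_right (s ^ 2 * ρ / 2) lo]

/-! ## Containments -/

/-- The far frame box `[ρ, ρ+1] × [-N, N]` lies in the rotated box `W_out × S`. -/
theorem farBox_subset {c s ρ N : ℝ} (hc : 0 < c) (hs : 0 < s) (hcs : c ^ 2 + s ^ 2 = 1) (hN : 1 ≤ N) :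
    Icc ρ (ρ + 1) ×ˢ Icc (-N) N ⊆ {q : ℝ × ℝ | (c * q.1 + s * q.2, -s * q.1 + c * q.2)
        ∈ Icc (c * ρ - N) (c * ρ + N + 1) ×ˢ Icc (-s * ρ - N - 1) (-s * ρ + N)} := by
  have hc1 := c_le_one hcs
  have hs1 := s_le_one hcs
  intro q hq
  simp only [mem_prod, mem_Icc] at hq
  obtain ⟨⟨h1, h2⟩, h3, h4⟩ := hq
  simp only [mem_setOf_eq, mem_prod, mem_Icc]
  have e1 : s * q.2 ≤ s * N := mul_le_mul_of_nonneg_left h4 hs.le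
  have e2 : s * -N ≤ s * q.2 := mul_le_mul_of_nonneg_left h3 hs.le
  have e3 : c * ρ ≤ c * q.1 := mul_le_mul_of_nonneg_left h1 hc.le
  have e4 : c * q.1 ≤ c * (ρ + 1) := mul_le_mul_of_nonneg_left h2 hc.le
  have e5 : c * q.2 ≤ c * N := mul_le_mul_of_nonneg_left h4 hc.le
  have e6 : c * -N ≤ c * q.2 := mul_le_mul_of_nonneg_left h3 hc.le
  have e7 : s * ρ ≤ s * q.1 := mul_le_mul_of_nonneg_left h1 hs.le
  have e8 : s * q.1 ≤ s * (ρ + 1) := mul_le_mul_of_nonneg_left h2 hs.le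
  have e9 : s * N ≤ N := by nlinarith
  have e10 : c * N ≤ N := by nlinarith
  refine ⟨⟨?_, ?_⟩, ?_, ?_⟩ <;> nlinarith

/-- `V = [-a₁, a₁] × T` lies in the tail set `{|q₁| ≥ n₀}` once `N + n₀ ≤ scρ/2`. -/
theorem innerBox_subset_tail {c s ρ N n₀ a₁ : ℝ} (hn₀ : 0 ≤ n₀) (hρ3 : N + n₀ ≤ s * c * ρ / 2) :
    Icc (-a₁) a₁ ×ˢ Icc (-(3 / 4) * s * c * ρ - N - 1) (-(s * c * ρ) / 2 + N)
      ⊆ {q : ℝ × ℝ | n₀ ≤ |q.2|} := by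
  intro q hq
  simp only [mem_prod, mem_Icc] at hq
  simp only [mem_setOf_eq]
  have h : q.2 ≤ -n₀ := by linarith [hq.2.2]
  rw [abs_of_nonpos (by linarith)]
  linarith

/-! ## Integrating the fibre inequalities -/

/-- From an a.e. fibrewise inequality `r·f ≤ g` to `r·∫f ≤ ∫g`. -/
theorem lintegral_ratio_le {μ : Measure (ℝ × ℝ)} {r : ℝ} {f g : ℝ × ℝ → ℝ≥0∞}
    (h : ∀ᵐ z ∂μ, ENNReal.ofReal r * f z ≤ g z) :
    ENNReal.ofReal r * ∫⁻ z, f z ∂μ ≤ ∫⁻ z, g z ∂μ := by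
  rw [← lintegral_const_mul' _ _ ENNReal.ofReal_ne_top]
  exact lintegral_mono_ae h

end Summit.QuantumFields.YangMills.Theorems.F4SubCurvatureDoorTwoMirrorFibres

end
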